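import Summits.QuantumFields.YangMills.Theorems.FluctuationComparisonRegPrIntLOrganTangentILawRegOfBetaAndIncr
import Summits.QuantumFields.YangMills.Theorems.FluctuationComparisonRegPrIntLOrganTangentFrameLettersOfD0Primitives
import HarnessLib

/-!
# Crux `FluctuationComparisonRegPrIntL` (stmt-QuantumFields-20520, rung R3), PATH-B organ (covariant organ of record, RULING №56) — (L55) «REG′ FROM (β)×2 + (I-geo)sq + THE FRAME +
# D0's PRIMITIVES, END TO END» (LEAD w3 g28 №35: «the one-line statement the planners and the successor LEAD will cite — REG′ ⟸ D0 primitives + (β) — IN THE TREE by name»):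
# ✓p823910's (W-Lip) letter `weightLip_of_beta_of_incr` and its three REG′ block theorems `ilawRegX∕V3∕Sq_of_beta_of_incr` RE-ISSUED with every CHART-side binder replaced by D0's
# primitives and structure letters through the landed docks ✓(L50b) ✓(L53) ✓(L54); conclusions byte-identical

Cell `ym3-torus` (YM ladder rung R3 = continuum `SU(2)` Yang–Mills on the three-torus — a RUNG: NOT d = 4, NOT infinite volume, NOT a mass gap, NOT Clay).
Width seat `ym-ust-20520-w5` (gen 26), `--kind proof --supports stmt-QuantumFields-20520 --as helper`, count-neutral, DEFINITION-FREE, default heartbeats,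
no registry ∕ binder ∕ `Lines/` edit.  Over ✓p823910 `…OrganTangentILawRegOfBetaAndIncr` (`weightLip_of_beta_of_incr`) and ✓`…OrganTangentILawRegOfWeightLip`
(`ilawRegX∕V3∕Sq_of_weightLip`), ✓p827906 (L50b) `dlinkPath∕dlinkSquare_of_dmin_dwhite`, ✓p829092 (L53) `jLipPath∕jLipSquare_of_cJ_chiRead_dwhite`, ✓(L54)
`hJle_of_primitives`∕`hcont_of_primitives`.

THE BINDER SURGERY (everything else = ✓p823910's binders VERBATIM, in order): `(J) (CJ) (hJle)` and `(hcont)` ↦ `(J) (cJ) (χ) (hJfac)` (Jfac), `(Amin) (Wh) (hΦw)` (Φw), `(S) (hχread)`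
(χ-read, RULING №57 (i)), `(Cc Kc) (hCc) (hKc) (hcJglob : ∀ V, |cJ V| ≤ Cc)`, `(hAmin) (hWh) (hcJ)` (window continuity of the three primitives); `(KJ)` ↦ ∅ (computed:
`toNNReal ((Cc·(√3·Σ_{e∈S} kW e) + 1·Kc)·(√3·(rc·(θ_j∕4))))`); `(hPJ) (hPincr) (hSJ) (hSincr)` ↦ `(δ₀) (hδ₀ : √3·(δ·(rc·(θ_j∕4))) ≤ δ₀)`, `(kA kW) (hkA0) (hkW0)`,
`(hk : ∀ e, (π∕2)·√3·(√3·kA e + (π∕2)·√3·kW e)·(√3·(rc·(θ_j∕4))) ≤ k e)` (the consumer's modulus `k` — which enters `hK`, `hkμ`, `h24` — dominates the D0 modulus), `(hDmin)`,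
`(hDwhite)` (✓(L50b)'s texts VERBATIM), `(hcLip)` (✓(L50b)'s).  The letter list of REG′ thus reads: frame (`hρc hρ′c hρpos hθ hχc hχsupp`), (β)×2 (`hβ hβ′`), the windows∕rows
(`hθj hrc hguard hδ hk0 hK hkμ hwin hrad hθmax0 hθle h24`; `c hc Db hDb0 DP hDb hdisp hroom` for the blocks), and D0 = {(Jfac), (Φw), (χ-read), `Amin`∕`Wh`∕`cJ` continuous on the
window, `|cJ| ≤ Cc`, (cJ-Lip), (Dmin), (Dwhite∣MW)} — (Dwhite∣MW) itself ⟸ ✓p828894 (L52) ⟸ px19's whitening-kernel letters.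
INHABITATION (★★OWNER RULING №100): the D0 binders are LAW-FREE structure∕regularity statements about the chart primitives; (β)×2 is the S2β lane's analyticity letter; no cross-law object.

WHAT.  ★★★`weightLip_of_beta_of_D0` (conclusion = ✓`weightLip_of_beta_of_incr`'s `∃ bW, …` VERBATIM); ★★★`ilawRegX_of_beta_of_D0`, ★★★`ilawRegV3_of_beta_of_D0`, ★★★`ilawRegSq_of_beta_of_D0`
(conclusions = the REG′ conjunct texts of ✓p821651's `hIlawX` ∕ `hIlawV3` ∕ `hIlawL`–`hIlawV4` VERBATIM, as in ✓p823910).  Proofs: `hPincr`∕`hSincr` from ✓`dlinkPath∕Square_of_dmin_dwhite` +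
`hk`; `hPJ`∕`hSJ` from ✓`jLipPath∕Square_of_cJ_chiRead_dwhite`; `hJle`∕`hcont` from ✓(L54); then ✓`weightLip_of_beta_of_incr` and ✓`ilawReg*_of_weightLip` by `exact`.

HONEST FRAMING: bookkeeping — an end-to-end junction over landed doors; every D0 binder, (β)×2 and the rows remain HYPOTHESES (D0 = crux 19200 EX ∧ V2′; (β) = the S2β lane);
nothing of Bałaban's analysis is asserted or proved; KER′ letters, (I-curv), (I-cov), rows v0.1–v0.4 UNDISCHARGED; the five registered stubs of `Lines/semiclassical_s2beta.lean`,
crux 20520 and `YM3TorusSU2` are NOT proved; registry untouched; rung R3 = SU(2) YM₃ on T³ — NOT d = 4, NOT infinite volume, NOT a mass gap, NOT Clay; the Yang–Mills mass gap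
is NOT proved.  [folklore]
-/

set_option autoImplicit false

noncomputable section

namespace Summit.QuantumFields.YangMills.Theorems.OrganTangentRegOfD0Primitives

open MeasureTheory Set Function Finset
open scoped BigOperators NNReal
open Literature.MathematicalPhysics.QuantumFieldTheory
open Literature.MathematicalPhysics.QuantumFieldTheory.Balaban1983to89 T3ContinuumYM3Torus T3NestedUnitLaws
  T3UnitLawDensityEML T4Continuum BalabanUVClass T3UnitScaleTilt T3LevelShift T3TiltDescent
open T4CubeChartExp (expPt toE)
open Summit.QuantumFields.YangMills.Theorems.BlockAvgCorrector (stokesConst)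
open Summit.QuantumFields.YangMills.Theorems.FluctuationComparisonRegPrIntLRunpairOrganFibreLaw (mwCut wNum)
open Summit.QuantumFields.YangMills.Theorems.OrganTangentILawRegOfBetaAndIncr (weightLip_of_beta_of_incr)
open Summit.QuantumFields.YangMills.Theorems.OrganTangentILawRegOfWeightLip (ilawRegX_of_weightLip ilawRegV3_of_weightLip ilawRegSq_of_weightLip)
open Summit.QuantumFields.YangMills.Theorems.OrganTangentD0ChartLettersWhitened (dlinkPath_of_dmin_dwhite dlinkSquare_of_dmin_dwhite)
open Summit.QuantumFields.YangMills.Theorems.OrganTangentChiOfReadDwhite (jLipPath_of_cJ_chiRead_dwhite jLipSquare_of_cJ_chiRead_dwhite)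
open Summit.QuantumFields.YangMills.Theorems.OrganTangentFrameLettersOfD0Primitives (hJle_of_primitives hcont_of_primitives)

/-- ★★★ **REG′'s (W-Lip) LETTER FROM (β)×2 + (I-geo)sq + THE FRAME + D0's PRIMITIVES** — ✓p823910 `weightLip_of_beta_of_incr`'s conclusion VERBATIM; its chart-side binders
{`hJle`, `hcont`, `KJ`, `hPJ`, `hPincr`, `hSJ`, `hSincr`} REPLACED by {(Jfac), (Φw), (χ-read), window continuity of `Amin`∕`Wh`∕`cJ`, `|cJ| ≤ Cc`, (cJ-Lip), (Dmin), (Dwhite∣MW), `hk`}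
(✓(L54) `hJle∕hcont_of_primitives`, ✓(L53) `jLipPath∕Square_of_cJ_chiRead_dwhite`, ✓(L50b) `dlinkPath∕Square_of_dmin_dwhite`). [cite: Balaban1985UV3, p.260 L25-31] -/
theorem weightLip_of_beta_of_D0 (F : T3Family) (γ b₀ p₀ : ℝ) (j Ts : ℕ) (hjTs : j + 1 ≤ Ts)
    (ρ ρ' : (i : ℕ) → GaugeField (F.P i) 0 ↥(Matrix.specialUnitaryGroup (Fin 2) ℂ) → ℝ)
    (hρc : ContinuousOn (ρ Ts) {U | PlaqSmall (θBal F.L γ b₀ p₀ Ts) U}) (hρ'c : ContinuousOn (ρ' Ts) {U | PlaqSmall (θBal F.L γ b₀ p₀ Ts) U})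
    (hρpos : ∀ U, PlaqSmall (θBal F.L γ b₀ p₀ Ts) U → 0 < ρ Ts U ∧ 0 < ρ' Ts U) (hθ : ∀ n, 0 < θBal F.L γ b₀ p₀ n)
    (hχc : Continuous (mwCut F γ b₀ p₀ j Ts))
    (hχsupp : ∀ U, mwCut F γ b₀ p₀ j Ts U ≠ 0 → ∀ (n : ℕ) (hjn : j + 1 ≤ n) (hnK : n ≤ Ts), PlaqSmall (24 / 25 * θBal F.L γ b₀ p₀ n) (descendTo F ℰp n Ts hnK U))
    (rA Bρ Bρ' : ℝ) (hrA : 0 < rA)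
    (hβ : ∀ (U : GaugeField (F.P Ts) 0 ↥(Matrix.specialUnitaryGroup (Fin 2) ℂ)), PlaqSmall (49 / 50 * θBal F.L γ b₀ p₀ Ts) U →
      ∀ (b b' : PBond (F.P Ts) 0) (v v' : Fin 3 → ℝ), ‖v‖ ≤ 1 → ‖v'‖ ≤ 1 →
        ∃ g : ℂ × ℂ → ℂ, DifferentiableOn ℂ g (Metric.ball (0 : ℂ) (rA * (49 / 50 * θBal F.L γ b₀ p₀ Ts)) ×ˢ Metric.ball (0 : ℂ) (rA * (49 / 50 * θBal F.L γ b₀ p₀ Ts))) ∧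
          (∀ (s t : ℝ) (V Z : GaugeField (F.P Ts) 0 ↥(Matrix.specialUnitaryGroup (Fin 2) ℂ)), |s| < rA * (49 / 50 * θBal F.L γ b₀ p₀ Ts) → |t| < rA * (49 / 50 * θBal F.L γ b₀ p₀ Ts) →
            (∀ e, e ≠ b → V e = U e) → V b = U b * expPt (s • v) → (∀ e, e ≠ b' → Z e = V e) → Z b' = V b' * expPt (t • v') →
            g ((s : ℂ), (t : ℂ)) = (((Real.log (ρ Ts Z)) : ℝ) : ℂ)) ∧
          ∀ z ∈ Metric.ball (0 : ℂ) (rA * (49 / 50 * θBal F.L γ b₀ p₀ Ts)) ×ˢ Metric.ball (0 : ℂ) (rA * (49 / 50 * θBal F.L γ b₀ p₀ Ts)), ‖g z - g 0‖ ≤ Bρ)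
    (hβ' : ∀ (U : GaugeField (F.P Ts) 0 ↥(Matrix.specialUnitaryGroup (Fin 2) ℂ)), PlaqSmall (49 / 50 * θBal F.L γ b₀ p₀ Ts) U →
      ∀ (b b' : PBond (F.P Ts) 0) (v v' : Fin 3 → ℝ), ‖v‖ ≤ 1 → ‖v'‖ ≤ 1 →
        ∃ g : ℂ × ℂ → ℂ, DifferentiableOn ℂ g (Metric.ball (0 : ℂ) (rA * (49 / 50 * θBal F.L γ b₀ p₀ Ts)) ×ˢ Metric.ball (0 : ℂ) (rA * (49 / 50 * θBal F.L γ b₀ p₀ Ts))) ∧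
          (∀ (s t : ℝ) (V Z : GaugeField (F.P Ts) 0 ↥(Matrix.specialUnitaryGroup (Fin 2) ℂ)), |s| < rA * (49 / 50 * θBal F.L γ b₀ p₀ Ts) → |t| < rA * (49 / 50 * θBal F.L γ b₀ p₀ Ts) →
            (∀ e, e ≠ b → V e = U e) → V b = U b * expPt (s • v) → (∀ e, e ≠ b' → Z e = V e) → Z b' = V b' * expPt (t • v') →
            g ((s : ℂ), (t : ℂ)) = (((Real.log (ρ' Ts Z)) : ℝ) : ℂ)) ∧
          ∀ z ∈ Metric.ball (0 : ℂ) (rA * (49 / 50 * θBal F.L γ b₀ p₀ Ts)) ×ˢ Metric.ball (0 : ℂ) (rA * (49 / 50 * θBal F.L γ b₀ p₀ Ts)), ‖g z - g 0‖ ≤ Bρ')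
    {Z : Type} [MeasurableSpace Z] (τ : Measure Z)
    (Φ : GaugeField (F.P j) 0 ↥(Matrix.specialUnitaryGroup (Fin 2) ℂ) × Z → GaugeField (F.P Ts) 0 ↥(Matrix.specialUnitaryGroup (Fin 2) ℂ))
    -- D0's primitives and structure letters (✓(L50b) (Φw)(Jfac), RULING №57 (χ-read)), their window continuity (✓(L54)), the z-free factor's bounds
    (J : GaugeField (F.P j) 0 ↥(Matrix.specialUnitaryGroup (Fin 2) ℂ) × Z → ℝ≥0) (cJ : GaugeField (F.P j) 0 ↥(Matrix.specialUnitaryGroup (Fin 2) ℂ) → ℝ) (χ : GaugeField (F.P j) 0 ↥(Matrix.specialUnitaryGroup (Fin 2) ℂ) → Z → ℝ) (hJfac : ∀ V z, (J (V, z) : ℝ) = cJ V * χ V z)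
    (Amin : GaugeField (F.P j) 0 ↥(Matrix.specialUnitaryGroup (Fin 2) ℂ) → GaugeField (F.P Ts) 0 ↥(Matrix.specialUnitaryGroup (Fin 2) ℂ)) (Wh : GaugeField (F.P j) 0 ↥(Matrix.specialUnitaryGroup (Fin 2) ℂ) → Z → PBond (F.P Ts) 0 → (Fin 3 → ℝ))
    (hΦw : ∀ V z e, Φ (V, z) e = Amin V e * expPt (Wh V z e))
    (S : Finset (PBond (F.P Ts) 0)) (hχread : ∀ V z, χ V z = ∏ e ∈ S, Real.sinc ‖toE (Wh V z e)‖ ^ 2)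
    (Cc Kc : ℝ) (hCc : 0 ≤ Cc) (hKc : 0 ≤ Kc) (hcJglob : ∀ V, |cJ V| ≤ Cc)
    (hAmin : ContinuousOn Amin {V | PlaqSmall (θBal F.L γ b₀ p₀ j) V}) (hWh : ∀ z, ContinuousOn (fun V => Wh V z) {V | PlaqSmall (θBal F.L γ b₀ p₀ j) V})
    (hcJ : ContinuousOn cJ {V | PlaqSmall (θBal F.L γ b₀ p₀ j) V})
    (hθj : 0 < θBal F.L γ b₀ p₀ j) (rc : ℝ) (hrc : 0 ≤ rc) (hguard : (1 + 16 * Real.sqrt 3 * rc) * (θBal F.L γ b₀ p₀ j / 4) ≤ θBal F.L γ b₀ p₀ j)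
    {θmax μ K δ : ℝ} (hδ : 0 < δ) (k : PBond (F.P Ts) 0 → ℝ) (hk0 : ∀ e, 0 ≤ k e) (hK : ∑ e, k e ≤ K)
    (hkμ : ∀ e, k e * δ ≤ μ) (hwin : 4 * (Real.sqrt 3 * μ) ≤ θBal F.L γ b₀ p₀ Ts / 50) (hrad : μ < rA * (49 / 50 * θBal F.L γ b₀ p₀ Ts))
    (hθmax0 : 0 ≤ θmax) (hθle : ∀ n', j + 1 ≤ n' → n' ≤ Ts → θBal F.L γ b₀ p₀ n' ≤ θmax)
    (h24 : stokesConst (F.P Ts) * (24 / 25 * θmax + 4 * ((30 * (((3 + 2) * F.L : ℕ) : ℝ)) ^ (Ts - (j + 1)) * (Real.sqrt 3 * K * δ))) ≤ 1 / 24)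
    -- the D0 chart letters (Dmin), (Dwhite∣MW) (✓(L50b) texts) and the modulus domination
    (δ₀ : ℝ) (hδ₀ : Real.sqrt 3 * (δ * (rc * (θBal F.L γ b₀ p₀ j / 4))) ≤ δ₀)
    (kA kW : PBond (F.P Ts) 0 → ℝ) (hkA0 : ∀ e, 0 ≤ kA e) (hkW0 : ∀ e, 0 ≤ kW e)
    (hk : ∀ e, Real.pi / 2 * Real.sqrt 3 * (Real.sqrt 3 * kA e + Real.pi / 2 * Real.sqrt 3 * kW e) * (Real.sqrt 3 * (rc * (θBal F.L γ b₀ p₀ j / 4))) ≤ k e)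
    (hDmin : ∀ (V : GaugeField (F.P j) 0 ↥(Matrix.specialUnitaryGroup (Fin 2) ℂ)) (b : PBond (F.P j) 0) (u : Fin 3 → ℝ), PlaqSmall (θBal F.L γ b₀ p₀ j) V →
      PlaqSmall (θBal F.L γ b₀ p₀ j) (update V b (V b * expPt u)) → ‖u‖ ≤ δ₀ →
      ∀ e, ∃ a : Fin 3 → ℝ, Amin (update V b (V b * expPt u)) e = Amin V e * expPt a ∧ ‖a‖ ≤ kA e * ‖u‖)
    (hDwhite : ∀ (z : Z) (V : GaugeField (F.P j) 0 ↥(Matrix.specialUnitaryGroup (Fin 2) ℂ)) (b : PBond (F.P j) 0) (u : Fin 3 → ℝ), PlaqSmall (θBal F.L γ b₀ p₀ j) V →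
      PlaqSmall (θBal F.L γ b₀ p₀ j) (update V b (V b * expPt u)) → ‖u‖ ≤ δ₀ →
      (∀ r ∈ Set.Ioo (0:ℝ) 1, ∀ (n : ℕ) (hjn : j + 1 ≤ n) (hnK : n ≤ Ts), PlaqSmall (24 / 25 * θBal F.L γ b₀ p₀ n) (descendTo F ℰp n Ts hnK (Φ (update V b (V b * expPt (r • u)), z)))) →
      ∀ e, ‖Wh (update V b (V b * expPt u)) z e - Wh V z e‖ ≤ kW e * ‖u‖)
    (hcLip : ∀ (V : GaugeField (F.P j) 0 ↥(Matrix.specialUnitaryGroup (Fin 2) ℂ)) (b : PBond (F.P j) 0) (u : Fin 3 → ℝ), PlaqSmall (θBal F.L γ b₀ p₀ j) V →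
      PlaqSmall (θBal F.L γ b₀ p₀ j) (update V b (V b * expPt u)) → ‖u‖ ≤ δ₀ → |cJ (update V b (V b * expPt u)) - cJ V| ≤ Kc * ‖u‖) :
    ∃ bW : ℝ, ∀ t : ℝ, 0 ≤ t → t ≤ 1 →
      (∀ (B' : PBond (F.P j) 0) (m' : Fin 3 → ℝ) (U₂ : GaugeField (F.P j) 0 ↥(Matrix.specialUnitaryGroup (Fin 2) ℂ))
        (X : ℝ → GaugeField (F.P j) 0 ↥(Matrix.specialUnitaryGroup (Fin 2) ℂ)), ‖m'‖ ≤ rc * (θBal F.L γ b₀ p₀ j / 4) → PlaqSmall (θBal F.L γ b₀ p₀ j / 4) U₂ →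
        (∀ s e, e ≠ B' → X s e = U₂ e) → (∀ s, X s B' = U₂ B' * expPt (s • m')) →
        ∀ᵐ z ∂τ, LipschitzOnWith (Real.nnabs bW) (fun s => wNum F γ b₀ p₀ j Ts ρ ρ' Φ J t (X s) z) (Set.Ioo (-1) 2)) ∧
      (∀ (B B' : PBond (F.P j) 0) (m m' : Fin 3 → ℝ) (V00 : GaugeField (F.P j) 0 ↥(Matrix.specialUnitaryGroup (Fin 2) ℂ))
        (Y : ℝ → GaugeField (F.P j) 0 ↥(Matrix.specialUnitaryGroup (Fin 2) ℂ)) (X : ℝ → ℝ → GaugeField (F.P j) 0 ↥(Matrix.specialUnitaryGroup (Fin 2) ℂ)),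
        ‖m‖ ≤ rc * (θBal F.L γ b₀ p₀ j / 4) → ‖m'‖ ≤ rc * (θBal F.L γ b₀ p₀ j / 4) → PlaqSmall (θBal F.L γ b₀ p₀ j / 4) V00 →
        (∀ s e, e ≠ B → Y s e = V00 e) → (∀ s, Y s B = V00 B * expPt (s • m)) → (∀ s s' e, e ≠ B' → X s s' e = Y s e) → (∀ s s', X s s' B' = Y s B' * expPt (s' • m')) →
        ∀ s' ∈ Set.Icc (0:ℝ) 1, ∀ᵐ z ∂τ, LipschitzOnWith (Real.nnabs bW) (fun s => wNum F γ b₀ p₀ j Ts ρ ρ' Φ J t (X s s') z) (Set.Ioo (-1) 2)) := by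
  have hcbdd : ∀ V : GaugeField (F.P j) 0 ↥(Matrix.specialUnitaryGroup (Fin 2) ℂ), PlaqSmall (θBal F.L γ b₀ p₀ j) V → |cJ V| ≤ Cc := fun V _ => hcJglob V
  refine weightLip_of_beta_of_incr F γ b₀ p₀ j Ts hjTs ρ ρ' hρc hρ'c hρpos hθ hχc hχsupp rA Bρ Bρ' hrA hβ hβ' τ Φ J Cc
    (hJle_of_primitives F j Ts J cJ χ hJfac Wh S hχread Cc hcJglob)
    (hcont_of_primitives F γ b₀ p₀ j Ts Φ Amin Wh hΦw J cJ χ hJfac S hχread hAmin hWh hcJ) hθj rc hrc hguard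
    (Real.toNNReal ((Cc * (Real.sqrt 3 * ∑ e ∈ S, kW e) + 1 * Kc) * (Real.sqrt 3 * (rc * (θBal F.L γ b₀ p₀ j / 4))))) hδ k hk0 hK hkμ hwin hrad hθmax0 hθle h24
    (jLipPath_of_cJ_chiRead_dwhite F γ b₀ p₀ j Ts Φ J cJ χ hJfac Wh S hχread rc δ δ₀ hrc hδ hθj hguard hδ₀ Cc Kc hCc hKc kW hkW0 hcbdd hcLip hDwhite)
    ?_ (jLipSquare_of_cJ_chiRead_dwhite F γ b₀ p₀ j Ts Φ J cJ χ hJfac Wh S hχread rc δ δ₀ hrc hδ hθj hguard hδ₀ Cc Kc hCc hKc kW hkW0 hcbdd hcLip hDwhite) ?_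
  · intro B' m' U₂ X hm' hU₂ hoff hon z x hx y hy hgood s hs s' hs' hss e
    obtain ⟨w, hw, hle⟩ := dlinkPath_of_dmin_dwhite F γ b₀ p₀ j Ts Φ Amin Wh hΦw rc δ δ₀ hrc hθj hguard hδ₀ kA kW hkA0 hkW0 hDmin hDwhite
      B' m' U₂ X hm' hU₂ hoff hon z x hx y hy hgood s hs s' hs' hss e
    exact ⟨w, hw, hle.trans (mul_le_mul_of_nonneg_right (hk e) (abs_nonneg _))⟩
  · intro B B' m m' V00 Y X hm hm' hV00 hYoff hYon hXoff hXon s' hs' z x hx y hy hgood s hs s'' hs'' hss e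
    obtain ⟨w, hw, hle⟩ := dlinkSquare_of_dmin_dwhite F γ b₀ p₀ j Ts Φ Amin Wh hΦw rc δ δ₀ hrc hθj hguard hδ₀ kA kW hkA0 hkW0 hDmin hDwhite
      B B' m m' V00 Y X hm hm' hV00 hYoff hYon hXoff hXon s' hs' z x hx y hy hgood s hs s'' hs'' hss e
    exact ⟨w, hw, hle.trans (mul_le_mul_of_nonneg_right (hk e) (abs_nonneg _))⟩

/-- ★★★ **REG′ OF THE (I-law-X)sq BLOCK FROM (β)×2 + (I-geo)sq + THE FRAME + D0's PRIMITIVES** — conclusion = ✓`ilawRegX_of_beta_of_incr`'s (the REG′ conjunct text of ✓p821651)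
VERBATIM. [cite: Balaban1985UV3, p.260 L25-31] -/
theorem ilawRegX_of_beta_of_D0 (F : T3Family) (γ b₀ p₀ : ℝ) (j Ts : ℕ) (hjTs : j + 1 ≤ Ts)
    (ρ ρ' : (i : ℕ) → GaugeField (F.P i) 0 ↥(Matrix.specialUnitaryGroup (Fin 2) ℂ) → ℝ)
    (hρc : ContinuousOn (ρ Ts) {U | PlaqSmall (θBal F.L γ b₀ p₀ Ts) U}) (hρ'c : ContinuousOn (ρ' Ts) {U | PlaqSmall (θBal F.L γ b₀ p₀ Ts) U})
    (hρpos : ∀ U, PlaqSmall (θBal F.L γ b₀ p₀ Ts) U → 0 < ρ Ts U ∧ 0 < ρ' Ts U) (hθ : ∀ n, 0 < θBal F.L γ b₀ p₀ n)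
    (hχc : Continuous (mwCut F γ b₀ p₀ j Ts))
    (hχsupp : ∀ U, mwCut F γ b₀ p₀ j Ts U ≠ 0 → ∀ (n : ℕ) (hjn : j + 1 ≤ n) (hnK : n ≤ Ts), PlaqSmall (24 / 25 * θBal F.L γ b₀ p₀ n) (descendTo F ℰp n Ts hnK U))
    (rA Bρ Bρ' : ℝ) (hrA : 0 < rA)
    (hβ : ∀ (U : GaugeField (F.P Ts) 0 ↥(Matrix.specialUnitaryGroup (Fin 2) ℂ)), PlaqSmall (49 / 50 * θBal F.L γ b₀ p₀ Ts) U →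
      ∀ (b b' : PBond (F.P Ts) 0) (v v' : Fin 3 → ℝ), ‖v‖ ≤ 1 → ‖v'‖ ≤ 1 →
        ∃ g : ℂ × ℂ → ℂ, DifferentiableOn ℂ g (Metric.ball (0 : ℂ) (rA * (49 / 50 * θBal F.L γ b₀ p₀ Ts)) ×ˢ Metric.ball (0 : ℂ) (rA * (49 / 50 * θBal F.L γ b₀ p₀ Ts))) ∧
          (∀ (s t : ℝ) (V Z : GaugeField (F.P Ts) 0 ↥(Matrix.specialUnitaryGroup (Fin 2) ℂ)), |s| < rA * (49 / 50 * θBal F.L γ b₀ p₀ Ts) → |t| < rA * (49 / 50 * θBal F.L γ b₀ p₀ Ts) →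
            (∀ e, e ≠ b → V e = U e) → V b = U b * expPt (s • v) → (∀ e, e ≠ b' → Z e = V e) → Z b' = V b' * expPt (t • v') →
            g ((s : ℂ), (t : ℂ)) = (((Real.log (ρ Ts Z)) : ℝ) : ℂ)) ∧
          ∀ z ∈ Metric.ball (0 : ℂ) (rA * (49 / 50 * θBal F.L γ b₀ p₀ Ts)) ×ˢ Metric.ball (0 : ℂ) (rA * (49 / 50 * θBal F.L γ b₀ p₀ Ts)), ‖g z - g 0‖ ≤ Bρ)
    (hβ' : ∀ (U : GaugeField (F.P Ts) 0 ↥(Matrix.specialUnitaryGroup (Fin 2) ℂ)), PlaqSmall (49 / 50 * θBal F.L γ b₀ p₀ Ts) U →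
      ∀ (b b' : PBond (F.P Ts) 0) (v v' : Fin 3 → ℝ), ‖v‖ ≤ 1 → ‖v'‖ ≤ 1 →
        ∃ g : ℂ × ℂ → ℂ, DifferentiableOn ℂ g (Metric.ball (0 : ℂ) (rA * (49 / 50 * θBal F.L γ b₀ p₀ Ts)) ×ˢ Metric.ball (0 : ℂ) (rA * (49 / 50 * θBal F.L γ b₀ p₀ Ts))) ∧
          (∀ (s t : ℝ) (V Z : GaugeField (F.P Ts) 0 ↥(Matrix.specialUnitaryGroup (Fin 2) ℂ)), |s| < rA * (49 / 50 * θBal F.L γ b₀ p₀ Ts) → |t| < rA * (49 / 50 * θBal F.L γ b₀ p₀ Ts) →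
            (∀ e, e ≠ b → V e = U e) → V b = U b * expPt (s • v) → (∀ e, e ≠ b' → Z e = V e) → Z b' = V b' * expPt (t • v') →
            g ((s : ℂ), (t : ℂ)) = (((Real.log (ρ' Ts Z)) : ℝ) : ℂ)) ∧
          ∀ z ∈ Metric.ball (0 : ℂ) (rA * (49 / 50 * θBal F.L γ b₀ p₀ Ts)) ×ˢ Metric.ball (0 : ℂ) (rA * (49 / 50 * θBal F.L γ b₀ p₀ Ts)), ‖g z - g 0‖ ≤ Bρ')
    {Z : Type} [MeasurableSpace Z] (τ : Measure Z) [IsFiniteMeasure τ]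
    (Φ : GaugeField (F.P j) 0 ↥(Matrix.specialUnitaryGroup (Fin 2) ℂ) × Z → GaugeField (F.P Ts) 0 ↥(Matrix.specialUnitaryGroup (Fin 2) ℂ))
    -- D0's primitives and structure letters (✓(L50b) (Φw)(Jfac), RULING №57 (χ-read)), their window continuity (✓(L54)), the z-free factor's bounds
    (J : GaugeField (F.P j) 0 ↥(Matrix.specialUnitaryGroup (Fin 2) ℂ) × Z → ℝ≥0) (cJ : GaugeField (F.P j) 0 ↥(Matrix.specialUnitaryGroup (Fin 2) ℂ) → ℝ) (χ : GaugeField (F.P j) 0 ↥(Matrix.specialUnitaryGroup (Fin 2) ℂ) → Z → ℝ) (hJfac : ∀ V z, (J (V, z) : ℝ) = cJ V * χ V z)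
    (Amin : GaugeField (F.P j) 0 ↥(Matrix.specialUnitaryGroup (Fin 2) ℂ) → GaugeField (F.P Ts) 0 ↥(Matrix.specialUnitaryGroup (Fin 2) ℂ)) (Wh : GaugeField (F.P j) 0 ↥(Matrix.specialUnitaryGroup (Fin 2) ℂ) → Z → PBond (F.P Ts) 0 → (Fin 3 → ℝ))
    (hΦw : ∀ V z e, Φ (V, z) e = Amin V e * expPt (Wh V z e))
    (S : Finset (PBond (F.P Ts) 0)) (hχread : ∀ V z, χ V z = ∏ e ∈ S, Real.sinc ‖toE (Wh V z e)‖ ^ 2)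
    (Cc Kc : ℝ) (hCc : 0 ≤ Cc) (hKc : 0 ≤ Kc) (hcJglob : ∀ V, |cJ V| ≤ Cc)
    (hAmin : ContinuousOn Amin {V | PlaqSmall (θBal F.L γ b₀ p₀ j) V}) (hWh : ∀ z, ContinuousOn (fun V => Wh V z) {V | PlaqSmall (θBal F.L γ b₀ p₀ j) V})
    (hcJ : ContinuousOn cJ {V | PlaqSmall (θBal F.L γ b₀ p₀ j) V})
    (hθj : 0 < θBal F.L γ b₀ p₀ j) (rc : ℝ) (hrc : 0 ≤ rc) (hguard : (1 + 16 * Real.sqrt 3 * rc) * (θBal F.L γ b₀ p₀ j / 4) ≤ θBal F.L γ b₀ p₀ j)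
    {θmax μ K δ : ℝ} (hδ : 0 < δ) (k : PBond (F.P Ts) 0 → ℝ) (hk0 : ∀ e, 0 ≤ k e) (hK : ∑ e, k e ≤ K)
    (hkμ : ∀ e, k e * δ ≤ μ) (hwin : 4 * (Real.sqrt 3 * μ) ≤ θBal F.L γ b₀ p₀ Ts / 50) (hrad : μ < rA * (49 / 50 * θBal F.L γ b₀ p₀ Ts))
    (hθmax0 : 0 ≤ θmax) (hθle : ∀ n', j + 1 ≤ n' → n' ≤ Ts → θBal F.L γ b₀ p₀ n' ≤ θmax)
    (h24 : stokesConst (F.P Ts) * (24 / 25 * θmax + 4 * ((30 * (((3 + 2) * F.L : ℕ) : ℝ)) ^ (Ts - (j + 1)) * (Real.sqrt 3 * K * δ))) ≤ 1 / 24)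
    -- the D0 chart letters (Dmin), (Dwhite∣MW) (✓(L50b) texts) and the modulus domination
    (δ₀ : ℝ) (hδ₀ : Real.sqrt 3 * (δ * (rc * (θBal F.L γ b₀ p₀ j / 4))) ≤ δ₀)
    (kA kW : PBond (F.P Ts) 0 → ℝ) (hkA0 : ∀ e, 0 ≤ kA e) (hkW0 : ∀ e, 0 ≤ kW e)
    (hk : ∀ e, Real.pi / 2 * Real.sqrt 3 * (Real.sqrt 3 * kA e + Real.pi / 2 * Real.sqrt 3 * kW e) * (Real.sqrt 3 * (rc * (θBal F.L γ b₀ p₀ j / 4))) ≤ k e)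
    (hDmin : ∀ (V : GaugeField (F.P j) 0 ↥(Matrix.specialUnitaryGroup (Fin 2) ℂ)) (b : PBond (F.P j) 0) (u : Fin 3 → ℝ), PlaqSmall (θBal F.L γ b₀ p₀ j) V →
      PlaqSmall (θBal F.L γ b₀ p₀ j) (update V b (V b * expPt u)) → ‖u‖ ≤ δ₀ →
      ∀ e, ∃ a : Fin 3 → ℝ, Amin (update V b (V b * expPt u)) e = Amin V e * expPt a ∧ ‖a‖ ≤ kA e * ‖u‖)
    (hDwhite : ∀ (z : Z) (V : GaugeField (F.P j) 0 ↥(Matrix.specialUnitaryGroup (Fin 2) ℂ)) (b : PBond (F.P j) 0) (u : Fin 3 → ℝ), PlaqSmall (θBal F.L γ b₀ p₀ j) V →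
      PlaqSmall (θBal F.L γ b₀ p₀ j) (update V b (V b * expPt u)) → ‖u‖ ≤ δ₀ →
      (∀ r ∈ Set.Ioo (0:ℝ) 1, ∀ (n : ℕ) (hjn : j + 1 ≤ n) (hnK : n ≤ Ts), PlaqSmall (24 / 25 * θBal F.L γ b₀ p₀ n) (descendTo F ℰp n Ts hnK (Φ (update V b (V b * expPt (r • u)), z)))) →
      ∀ e, ‖Wh (update V b (V b * expPt u)) z e - Wh V z e‖ ≤ kW e * ‖u‖)
    (hcLip : ∀ (V : GaugeField (F.P j) 0 ↥(Matrix.specialUnitaryGroup (Fin 2) ℂ)) (b : PBond (F.P j) 0) (u : Fin 3 → ℝ), PlaqSmall (θBal F.L γ b₀ p₀ j) V →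
      PlaqSmall (θBal F.L γ b₀ p₀ j) (update V b (V b * expPt u)) → ‖u‖ ≤ δ₀ → |cJ (update V b (V b * expPt u)) - cJ V| ≤ Kc * ‖u‖)
    (c : ℝ) (hc : c < 1) (Db : ℝ) (hDb0 : 0 ≤ Db) (DP : Plaq (F.P Ts) 0 → PBond (F.P j) 0 → ℝ) (hDb : ∀ p b, DP p b ≤ Db)
    (hdisp : ∀ (z : Z) (X : GaugeField (F.P j) 0 ↥(Matrix.specialUnitaryGroup (Fin 2) ℂ)), PlaqSmall (θBal F.L γ b₀ p₀ j) X →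
      ∀ (b : PBond (F.P j) 0) (v : Fin 3 → ℝ), ‖v‖ ≤ rc * (θBal F.L γ b₀ p₀ j / 4) → ∀ s ∈ Icc (0 : ℝ) 1, ∀ p : Plaq (F.P Ts) 0,
        dist1 (GaugeField.plaqHol (Φ (update X b (X b * expPt (s • v)), z)) p)
          ≤ dist1 (GaugeField.plaqHol (Φ (X, z)) p) + DP p b * (‖v‖ / (θBal F.L γ b₀ p₀ j / 4)))
    (hroom : 24 / 25 * θBal F.L γ b₀ p₀ Ts + 3 * (Db * rc) ≤ c * θBal F.L γ b₀ p₀ Ts) (t : ℝ) (ht0 : 0 ≤ t) (ht1 : t ≤ 1) :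
    ∀ (B B' : PBond (F.P j) 0) (m m' : Fin 3 → ℝ) (U₁ V₁ W₂ : GaugeField (F.P j) 0 ↥(Matrix.specialUnitaryGroup (Fin 2) ℂ)), ‖m‖ ≤ rc * (θBal F.L γ b₀ p₀ j / 4) → ‖m'‖ ≤ rc * (θBal F.L γ b₀ p₀ j / 4) → PlaqSmall (θBal F.L γ b₀ p₀ j / 4) U₁ → PlaqSmall (θBal F.L γ b₀ p₀ j / 4) V₁ → PlaqSmall (θBal F.L γ b₀ p₀ j / 4) W₂ → (∀ e, e ≠ B → V₁ e = U₁ e) → V₁ B = U₁ B * expPt m → (∀ e, e ≠ B' → W₂ e = V₁ e) → W₂ B' = V₁ B' * expPt m' → ∀ (X : ℝ → GaugeField (F.P j) 0 ↥(Matrix.specialUnitaryGroup (Fin 2) ℂ)), (∀ s e, e ≠ B' → X s e = V₁ e) → (∀ s, X s B' = V₁ B' * expPt (s • m')) →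
      (∃ (b bΔ : Z → ℝ), Integrable b τ ∧ Integrable bΔ τ ∧
        (∀ᵐ z ∂τ, LipschitzOnWith (Real.nnabs (b z)) (fun s => wNum F γ b₀ p₀ j Ts ρ ρ' Φ J t (X s) z) (Set.Ioo (-1) 2)) ∧
        (∀ᵐ z ∂τ, LipschitzOnWith (Real.nnabs (bΔ z)) (fun s => ((Real.log (ρ Ts (Φ (V₁, z))) - Real.log (ρ' Ts (Φ (V₁, z)))) - (Real.log (ρ Ts (Φ (U₁, z))) - Real.log (ρ' Ts (Φ (U₁, z))))) * wNum F γ b₀ p₀ j Ts ρ ρ' Φ J t (X s) z) (Set.Ioo (-1) 2))) := by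
  obtain ⟨bW, hW⟩ := weightLip_of_beta_of_D0 F γ b₀ p₀ j Ts hjTs ρ ρ' hρc hρ'c hρpos hθ hχc hχsupp rA Bρ Bρ' hrA hβ hβ' τ Φ J cJ χ hJfac Amin Wh hΦw S hχread Cc Kc hCc hKc hcJglob hAmin hWh hcJ hθj rc hrc hguard hδ k hk0 hK hkμ hwin hrad hθmax0 hθle h24 δ₀ hδ₀ kA kW hkA0 hkW0 hk hDmin hDwhite hcLip
  exact ilawRegX_of_weightLip F γ b₀ p₀ j Ts hjTs ρ ρ' hρc hρ'c hρpos (hθ Ts) hχsupp τ Φ J c hc hθj Db rc hrc hDb0 DP hDb hguard hdisp hroom t bW (hW t ht0 ht1).1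

/-- ★★★ **REG′ OF THE (I-law-V3)sq BLOCK FROM (β)×2 + (I-geo)sq + THE FRAME + D0's PRIMITIVES** — conclusion = ✓`ilawRegV3_of_beta_of_incr`'s VERBATIM. [cite: Balaban1985UV3, p.260 L25-31] -/
theorem ilawRegV3_of_beta_of_D0 (F : T3Family) (γ b₀ p₀ : ℝ) (j Ts : ℕ) (hjTs : j + 1 ≤ Ts)
    (ρ ρ' : (i : ℕ) → GaugeField (F.P i) 0 ↥(Matrix.specialUnitaryGroup (Fin 2) ℂ) → ℝ)
    (hρc : ContinuousOn (ρ Ts) {U | PlaqSmall (θBal F.L γ b₀ p₀ Ts) U}) (hρ'c : ContinuousOn (ρ' Ts) {U | PlaqSmall (θBal F.L γ b₀ p₀ Ts) U})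
    (hρpos : ∀ U, PlaqSmall (θBal F.L γ b₀ p₀ Ts) U → 0 < ρ Ts U ∧ 0 < ρ' Ts U) (hθ : ∀ n, 0 < θBal F.L γ b₀ p₀ n)
    (hχc : Continuous (mwCut F γ b₀ p₀ j Ts))
    (hχsupp : ∀ U, mwCut F γ b₀ p₀ j Ts U ≠ 0 → ∀ (n : ℕ) (hjn : j + 1 ≤ n) (hnK : n ≤ Ts), PlaqSmall (24 / 25 * θBal F.L γ b₀ p₀ n) (descendTo F ℰp n Ts hnK U))
    (rA Bρ Bρ' : ℝ) (hrA : 0 < rA)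
    (hβ : ∀ (U : GaugeField (F.P Ts) 0 ↥(Matrix.specialUnitaryGroup (Fin 2) ℂ)), PlaqSmall (49 / 50 * θBal F.L γ b₀ p₀ Ts) U →
      ∀ (b b' : PBond (F.P Ts) 0) (v v' : Fin 3 → ℝ), ‖v‖ ≤ 1 → ‖v'‖ ≤ 1 →
        ∃ g : ℂ × ℂ → ℂ, DifferentiableOn ℂ g (Metric.ball (0 : ℂ) (rA * (49 / 50 * θBal F.L γ b₀ p₀ Ts)) ×ˢ Metric.ball (0 : ℂ) (rA * (49 / 50 * θBal F.L γ b₀ p₀ Ts))) ∧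
          (∀ (s t : ℝ) (V Z : GaugeField (F.P Ts) 0 ↥(Matrix.specialUnitaryGroup (Fin 2) ℂ)), |s| < rA * (49 / 50 * θBal F.L γ b₀ p₀ Ts) → |t| < rA * (49 / 50 * θBal F.L γ b₀ p₀ Ts) →
            (∀ e, e ≠ b → V e = U e) → V b = U b * expPt (s • v) → (∀ e, e ≠ b' → Z e = V e) → Z b' = V b' * expPt (t • v') →
            g ((s : ℂ), (t : ℂ)) = (((Real.log (ρ Ts Z)) : ℝ) : ℂ)) ∧
          ∀ z ∈ Metric.ball (0 : ℂ) (rA * (49 / 50 * θBal F.L γ b₀ p₀ Ts)) ×ˢ Metric.ball (0 : ℂ) (rA * (49 / 50 * θBal F.L γ b₀ p₀ Ts)), ‖g z - g 0‖ ≤ Bρ)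
    (hβ' : ∀ (U : GaugeField (F.P Ts) 0 ↥(Matrix.specialUnitaryGroup (Fin 2) ℂ)), PlaqSmall (49 / 50 * θBal F.L γ b₀ p₀ Ts) U →
      ∀ (b b' : PBond (F.P Ts) 0) (v v' : Fin 3 → ℝ), ‖v‖ ≤ 1 → ‖v'‖ ≤ 1 →
        ∃ g : ℂ × ℂ → ℂ, DifferentiableOn ℂ g (Metric.ball (0 : ℂ) (rA * (49 / 50 * θBal F.L γ b₀ p₀ Ts)) ×ˢ Metric.ball (0 : ℂ) (rA * (49 / 50 * θBal F.L γ b₀ p₀ Ts))) ∧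
          (∀ (s t : ℝ) (V Z : GaugeField (F.P Ts) 0 ↥(Matrix.specialUnitaryGroup (Fin 2) ℂ)), |s| < rA * (49 / 50 * θBal F.L γ b₀ p₀ Ts) → |t| < rA * (49 / 50 * θBal F.L γ b₀ p₀ Ts) →
            (∀ e, e ≠ b → V e = U e) → V b = U b * expPt (s • v) → (∀ e, e ≠ b' → Z e = V e) → Z b' = V b' * expPt (t • v') →
            g ((s : ℂ), (t : ℂ)) = (((Real.log (ρ' Ts Z)) : ℝ) : ℂ)) ∧
          ∀ z ∈ Metric.ball (0 : ℂ) (rA * (49 / 50 * θBal F.L γ b₀ p₀ Ts)) ×ˢ Metric.ball (0 : ℂ) (rA * (49 / 50 * θBal F.L γ b₀ p₀ Ts)), ‖g z - g 0‖ ≤ Bρ')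
    {Z : Type} [MeasurableSpace Z] (τ : Measure Z) [IsFiniteMeasure τ]
    (Φ : GaugeField (F.P j) 0 ↥(Matrix.specialUnitaryGroup (Fin 2) ℂ) × Z → GaugeField (F.P Ts) 0 ↥(Matrix.specialUnitaryGroup (Fin 2) ℂ))
    -- D0's primitives and structure letters (✓(L50b) (Φw)(Jfac), RULING №57 (χ-read)), their window continuity (✓(L54)), the z-free factor's bounds
    (J : GaugeField (F.P j) 0 ↥(Matrix.specialUnitaryGroup (Fin 2) ℂ) × Z → ℝ≥0) (cJ : GaugeField (F.P j) 0 ↥(Matrix.specialUnitaryGroup (Fin 2) ℂ) → ℝ) (χ : GaugeField (F.P j) 0 ↥(Matrix.specialUnitaryGroup (Fin 2) ℂ) → Z → ℝ) (hJfac : ∀ V z, (J (V, z) : ℝ) = cJ V * χ V z)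
    (Amin : GaugeField (F.P j) 0 ↥(Matrix.specialUnitaryGroup (Fin 2) ℂ) → GaugeField (F.P Ts) 0 ↥(Matrix.specialUnitaryGroup (Fin 2) ℂ)) (Wh : GaugeField (F.P j) 0 ↥(Matrix.specialUnitaryGroup (Fin 2) ℂ) → Z → PBond (F.P Ts) 0 → (Fin 3 → ℝ))
    (hΦw : ∀ V z e, Φ (V, z) e = Amin V e * expPt (Wh V z e))
    (S : Finset (PBond (F.P Ts) 0)) (hχread : ∀ V z, χ V z = ∏ e ∈ S, Real.sinc ‖toE (Wh V z e)‖ ^ 2)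
    (Cc Kc : ℝ) (hCc : 0 ≤ Cc) (hKc : 0 ≤ Kc) (hcJglob : ∀ V, |cJ V| ≤ Cc)
    (hAmin : ContinuousOn Amin {V | PlaqSmall (θBal F.L γ b₀ p₀ j) V}) (hWh : ∀ z, ContinuousOn (fun V => Wh V z) {V | PlaqSmall (θBal F.L γ b₀ p₀ j) V})
    (hcJ : ContinuousOn cJ {V | PlaqSmall (θBal F.L γ b₀ p₀ j) V})
    (hθj : 0 < θBal F.L γ b₀ p₀ j) (rc : ℝ) (hrc : 0 ≤ rc) (hguard : (1 + 16 * Real.sqrt 3 * rc) * (θBal F.L γ b₀ p₀ j / 4) ≤ θBal F.L γ b₀ p₀ j)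
    {θmax μ K δ : ℝ} (hδ : 0 < δ) (k : PBond (F.P Ts) 0 → ℝ) (hk0 : ∀ e, 0 ≤ k e) (hK : ∑ e, k e ≤ K)
    (hkμ : ∀ e, k e * δ ≤ μ) (hwin : 4 * (Real.sqrt 3 * μ) ≤ θBal F.L γ b₀ p₀ Ts / 50) (hrad : μ < rA * (49 / 50 * θBal F.L γ b₀ p₀ Ts))
    (hθmax0 : 0 ≤ θmax) (hθle : ∀ n', j + 1 ≤ n' → n' ≤ Ts → θBal F.L γ b₀ p₀ n' ≤ θmax)
    (h24 : stokesConst (F.P Ts) * (24 / 25 * θmax + 4 * ((30 * (((3 + 2) * F.L : ℕ) : ℝ)) ^ (Ts - (j + 1)) * (Real.sqrt 3 * K * δ))) ≤ 1 / 24)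
    -- the D0 chart letters (Dmin), (Dwhite∣MW) (✓(L50b) texts) and the modulus domination
    (δ₀ : ℝ) (hδ₀ : Real.sqrt 3 * (δ * (rc * (θBal F.L γ b₀ p₀ j / 4))) ≤ δ₀)
    (kA kW : PBond (F.P Ts) 0 → ℝ) (hkA0 : ∀ e, 0 ≤ kA e) (hkW0 : ∀ e, 0 ≤ kW e)
    (hk : ∀ e, Real.pi / 2 * Real.sqrt 3 * (Real.sqrt 3 * kA e + Real.pi / 2 * Real.sqrt 3 * kW e) * (Real.sqrt 3 * (rc * (θBal F.L γ b₀ p₀ j / 4))) ≤ k e)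
    (hDmin : ∀ (V : GaugeField (F.P j) 0 ↥(Matrix.specialUnitaryGroup (Fin 2) ℂ)) (b : PBond (F.P j) 0) (u : Fin 3 → ℝ), PlaqSmall (θBal F.L γ b₀ p₀ j) V →
      PlaqSmall (θBal F.L γ b₀ p₀ j) (update V b (V b * expPt u)) → ‖u‖ ≤ δ₀ →
      ∀ e, ∃ a : Fin 3 → ℝ, Amin (update V b (V b * expPt u)) e = Amin V e * expPt a ∧ ‖a‖ ≤ kA e * ‖u‖)
    (hDwhite : ∀ (z : Z) (V : GaugeField (F.P j) 0 ↥(Matrix.specialUnitaryGroup (Fin 2) ℂ)) (b : PBond (F.P j) 0) (u : Fin 3 → ℝ), PlaqSmall (θBal F.L γ b₀ p₀ j) V →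
      PlaqSmall (θBal F.L γ b₀ p₀ j) (update V b (V b * expPt u)) → ‖u‖ ≤ δ₀ →
      (∀ r ∈ Set.Ioo (0:ℝ) 1, ∀ (n : ℕ) (hjn : j + 1 ≤ n) (hnK : n ≤ Ts), PlaqSmall (24 / 25 * θBal F.L γ b₀ p₀ n) (descendTo F ℰp n Ts hnK (Φ (update V b (V b * expPt (r • u)), z)))) →
      ∀ e, ‖Wh (update V b (V b * expPt u)) z e - Wh V z e‖ ≤ kW e * ‖u‖)
    (hcLip : ∀ (V : GaugeField (F.P j) 0 ↥(Matrix.specialUnitaryGroup (Fin 2) ℂ)) (b : PBond (F.P j) 0) (u : Fin 3 → ℝ), PlaqSmall (θBal F.L γ b₀ p₀ j) V →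
      PlaqSmall (θBal F.L γ b₀ p₀ j) (update V b (V b * expPt u)) → ‖u‖ ≤ δ₀ → |cJ (update V b (V b * expPt u)) - cJ V| ≤ Kc * ‖u‖)
    (c : ℝ) (hc : c < 1) (Db : ℝ) (hDb0 : 0 ≤ Db) (DP : Plaq (F.P Ts) 0 → PBond (F.P j) 0 → ℝ) (hDb : ∀ p b, DP p b ≤ Db)
    (hdisp : ∀ (z : Z) (X : GaugeField (F.P j) 0 ↥(Matrix.specialUnitaryGroup (Fin 2) ℂ)), PlaqSmall (θBal F.L γ b₀ p₀ j) X →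
      ∀ (b : PBond (F.P j) 0) (v : Fin 3 → ℝ), ‖v‖ ≤ rc * (θBal F.L γ b₀ p₀ j / 4) → ∀ s ∈ Icc (0 : ℝ) 1, ∀ p : Plaq (F.P Ts) 0,
        dist1 (GaugeField.plaqHol (Φ (update X b (X b * expPt (s • v)), z)) p)
          ≤ dist1 (GaugeField.plaqHol (Φ (X, z)) p) + DP p b * (‖v‖ / (θBal F.L γ b₀ p₀ j / 4)))
    (hroom : 24 / 25 * θBal F.L γ b₀ p₀ Ts + 3 * (Db * rc) ≤ c * θBal F.L γ b₀ p₀ Ts) (t : ℝ) (ht0 : 0 ≤ t) (ht1 : t ≤ 1) :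
    ∀ (B B' : PBond (F.P j) 0) (m m' : Fin 3 → ℝ) (U₁ V₁ W₂ : GaugeField (F.P j) 0 ↥(Matrix.specialUnitaryGroup (Fin 2) ℂ)), ‖m‖ ≤ rc * (θBal F.L γ b₀ p₀ j / 4) → ‖m'‖ ≤ rc * (θBal F.L γ b₀ p₀ j / 4) → PlaqSmall (θBal F.L γ b₀ p₀ j / 4) U₁ → PlaqSmall (θBal F.L γ b₀ p₀ j / 4) V₁ → PlaqSmall (θBal F.L γ b₀ p₀ j / 4) W₂ → (∀ e, e ≠ B → V₁ e = U₁ e) → V₁ B = U₁ B * expPt m → (∀ e, e ≠ B' → W₂ e = V₁ e) → W₂ B' = V₁ B' * expPt m' → ∀ (X : ℝ → GaugeField (F.P j) 0 ↥(Matrix.specialUnitaryGroup (Fin 2) ℂ)), (∀ s e, e ≠ B' → X s e = V₁ e) → (∀ s, X s B' = V₁ B' * expPt (s • m')) →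
      (∃ (b bD bS bDS : Z → ℝ), Integrable b τ ∧ Integrable bD τ ∧ Integrable bS τ ∧ Integrable bDS τ ∧
        (∀ᵐ z ∂τ, LipschitzOnWith (Real.nnabs (b z)) (fun s => wNum F γ b₀ p₀ j Ts ρ ρ' Φ J t (X s) z) (Set.Ioo (-1) 2)) ∧
        (∀ᵐ z ∂τ, LipschitzOnWith (Real.nnabs (bD z)) (fun s => ((Real.log (ρ Ts (Φ (V₁, z))) - Real.log (ρ' Ts (Φ (V₁, z)))) - (Real.log (ρ Ts (Φ (U₁, z))) - Real.log (ρ' Ts (Φ (U₁, z))))) * wNum F γ b₀ p₀ j Ts ρ ρ' Φ J t (X s) z) (Set.Ioo (-1) 2)) ∧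
        (∀ᵐ z ∂τ, LipschitzOnWith (Real.nnabs (bS z)) (fun s => ((Real.log (ρ Ts (Φ (V₁, z))) - Real.log (ρ' Ts (Φ (V₁, z)))) + (Real.log (ρ Ts (Φ (U₁, z))) - Real.log (ρ' Ts (Φ (U₁, z))))) * wNum F γ b₀ p₀ j Ts ρ ρ' Φ J t (X s) z) (Set.Ioo (-1) 2)) ∧
        (∀ᵐ z ∂τ, LipschitzOnWith (Real.nnabs (bDS z)) (fun s => (((Real.log (ρ Ts (Φ (V₁, z))) - Real.log (ρ' Ts (Φ (V₁, z)))) - (Real.log (ρ Ts (Φ (U₁, z))) - Real.log (ρ' Ts (Φ (U₁, z))))) * ((Real.log (ρ Ts (Φ (V₁, z))) - Real.log (ρ' Ts (Φ (V₁, z)))) + (Real.log (ρ Ts (Φ (U₁, z))) - Real.log (ρ' Ts (Φ (U₁, z)))))) * wNum F γ b₀ p₀ j Ts ρ ρ' Φ J t (X s) z) (Set.Ioo (-1) 2))) := by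
  obtain ⟨bW, hW⟩ := weightLip_of_beta_of_D0 F γ b₀ p₀ j Ts hjTs ρ ρ' hρc hρ'c hρpos hθ hχc hχsupp rA Bρ Bρ' hrA hβ hβ' τ Φ J cJ χ hJfac Amin Wh hΦw S hχread Cc Kc hCc hKc hcJglob hAmin hWh hcJ hθj rc hrc hguard hδ k hk0 hK hkμ hwin hrad hθmax0 hθle h24 δ₀ hδ₀ kA kW hkA0 hkW0 hk hDmin hDwhite hcLip
  exact ilawRegV3_of_weightLip F γ b₀ p₀ j Ts hjTs ρ ρ' hρc hρ'c hρpos (hθ Ts) hχsupp τ Φ J c hc hθj Db rc hrc hDb0 DP hDb hguard hdisp hroom t bW (hW t ht0 ht1).1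

/-- ★★★ **REG′ OF THE (I-law-L)∕(I-law-V4) BLOCKS FROM (β)×2 + (I-geo)sq + THE FRAME + D0's PRIMITIVES** — conclusion = ✓`ilawRegSq_of_beta_of_incr`'s VERBATIM.
[cite: Balaban1985UV3, p.260 L25-31] -/
theorem ilawRegSq_of_beta_of_D0 (F : T3Family) (γ b₀ p₀ : ℝ) (j Ts : ℕ) (hjTs : j + 1 ≤ Ts)
    (ρ ρ' : (i : ℕ) → GaugeField (F.P i) 0 ↥(Matrix.specialUnitaryGroup (Fin 2) ℂ) → ℝ)
    (hρc : ContinuousOn (ρ Ts) {U | PlaqSmall (θBal F.L γ b₀ p₀ Ts) U}) (hρ'c : ContinuousOn (ρ' Ts) {U | PlaqSmall (θBal F.L γ b₀ p₀ Ts) U})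
    (hρpos : ∀ U, PlaqSmall (θBal F.L γ b₀ p₀ Ts) U → 0 < ρ Ts U ∧ 0 < ρ' Ts U) (hθ : ∀ n, 0 < θBal F.L γ b₀ p₀ n)
    (hχc : Continuous (mwCut F γ b₀ p₀ j Ts))
    (hχsupp : ∀ U, mwCut F γ b₀ p₀ j Ts U ≠ 0 → ∀ (n : ℕ) (hjn : j + 1 ≤ n) (hnK : n ≤ Ts), PlaqSmall (24 / 25 * θBal F.L γ b₀ p₀ n) (descendTo F ℰp n Ts hnK U))
    (rA Bρ Bρ' : ℝ) (hrA : 0 < rA)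
    (hβ : ∀ (U : GaugeField (F.P Ts) 0 ↥(Matrix.specialUnitaryGroup (Fin 2) ℂ)), PlaqSmall (49 / 50 * θBal F.L γ b₀ p₀ Ts) U →
      ∀ (b b' : PBond (F.P Ts) 0) (v v' : Fin 3 → ℝ), ‖v‖ ≤ 1 → ‖v'‖ ≤ 1 →
        ∃ g : ℂ × ℂ → ℂ, DifferentiableOn ℂ g (Metric.ball (0 : ℂ) (rA * (49 / 50 * θBal F.L γ b₀ p₀ Ts)) ×ˢ Metric.ball (0 : ℂ) (rA * (49 / 50 * θBal F.L γ b₀ p₀ Ts))) ∧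
          (∀ (s t : ℝ) (V Z : GaugeField (F.P Ts) 0 ↥(Matrix.specialUnitaryGroup (Fin 2) ℂ)), |s| < rA * (49 / 50 * θBal F.L γ b₀ p₀ Ts) → |t| < rA * (49 / 50 * θBal F.L γ b₀ p₀ Ts) →
            (∀ e, e ≠ b → V e = U e) → V b = U b * expPt (s • v) → (∀ e, e ≠ b' → Z e = V e) → Z b' = V b' * expPt (t • v') →
            g ((s : ℂ), (t : ℂ)) = (((Real.log (ρ Ts Z)) : ℝ) : ℂ)) ∧
          ∀ z ∈ Metric.ball (0 : ℂ) (rA * (49 / 50 * θBal F.L γ b₀ p₀ Ts)) ×ˢ Metric.ball (0 : ℂ) (rA * (49 / 50 * θBal F.L γ b₀ p₀ Ts)), ‖g z - g 0‖ ≤ Bρ)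
    (hβ' : ∀ (U : GaugeField (F.P Ts) 0 ↥(Matrix.specialUnitaryGroup (Fin 2) ℂ)), PlaqSmall (49 / 50 * θBal F.L γ b₀ p₀ Ts) U →
      ∀ (b b' : PBond (F.P Ts) 0) (v v' : Fin 3 → ℝ), ‖v‖ ≤ 1 → ‖v'‖ ≤ 1 →
        ∃ g : ℂ × ℂ → ℂ, DifferentiableOn ℂ g (Metric.ball (0 : ℂ) (rA * (49 / 50 * θBal F.L γ b₀ p₀ Ts)) ×ˢ Metric.ball (0 : ℂ) (rA * (49 / 50 * θBal F.L γ b₀ p₀ Ts))) ∧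
          (∀ (s t : ℝ) (V Z : GaugeField (F.P Ts) 0 ↥(Matrix.specialUnitaryGroup (Fin 2) ℂ)), |s| < rA * (49 / 50 * θBal F.L γ b₀ p₀ Ts) → |t| < rA * (49 / 50 * θBal F.L γ b₀ p₀ Ts) →
            (∀ e, e ≠ b → V e = U e) → V b = U b * expPt (s • v) → (∀ e, e ≠ b' → Z e = V e) → Z b' = V b' * expPt (t • v') →
            g ((s : ℂ), (t : ℂ)) = (((Real.log (ρ' Ts Z)) : ℝ) : ℂ)) ∧
          ∀ z ∈ Metric.ball (0 : ℂ) (rA * (49 / 50 * θBal F.L γ b₀ p₀ Ts)) ×ˢ Metric.ball (0 : ℂ) (rA * (49 / 50 * θBal F.L γ b₀ p₀ Ts)), ‖g z - g 0‖ ≤ Bρ')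
    {Z : Type} [MeasurableSpace Z] (τ : Measure Z) [IsFiniteMeasure τ]
    (Φ : GaugeField (F.P j) 0 ↥(Matrix.specialUnitaryGroup (Fin 2) ℂ) × Z → GaugeField (F.P Ts) 0 ↥(Matrix.specialUnitaryGroup (Fin 2) ℂ))
    -- D0's primitives and structure letters (✓(L50b) (Φw)(Jfac), RULING №57 (χ-read)), their window continuity (✓(L54)), the z-free factor's bounds
    (J : GaugeField (F.P j) 0 ↥(Matrix.specialUnitaryGroup (Fin 2) ℂ) × Z → ℝ≥0) (cJ : GaugeField (F.P j) 0 ↥(Matrix.specialUnitaryGroup (Fin 2) ℂ) → ℝ) (χ : GaugeField (F.P j) 0 ↥(Matrix.specialUnitaryGroup (Fin 2) ℂ) → Z → ℝ) (hJfac : ∀ V z, (J (V, z) : ℝ) = cJ V * χ V z)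
    (Amin : GaugeField (F.P j) 0 ↥(Matrix.specialUnitaryGroup (Fin 2) ℂ) → GaugeField (F.P Ts) 0 ↥(Matrix.specialUnitaryGroup (Fin 2) ℂ)) (Wh : GaugeField (F.P j) 0 ↥(Matrix.specialUnitaryGroup (Fin 2) ℂ) → Z → PBond (F.P Ts) 0 → (Fin 3 → ℝ))
    (hΦw : ∀ V z e, Φ (V, z) e = Amin V e * expPt (Wh V z e))
    (S : Finset (PBond (F.P Ts) 0)) (hχread : ∀ V z, χ V z = ∏ e ∈ S, Real.sinc ‖toE (Wh V z e)‖ ^ 2)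
    (Cc Kc : ℝ) (hCc : 0 ≤ Cc) (hKc : 0 ≤ Kc) (hcJglob : ∀ V, |cJ V| ≤ Cc)
    (hAmin : ContinuousOn Amin {V | PlaqSmall (θBal F.L γ b₀ p₀ j) V}) (hWh : ∀ z, ContinuousOn (fun V => Wh V z) {V | PlaqSmall (θBal F.L γ b₀ p₀ j) V})
    (hcJ : ContinuousOn cJ {V | PlaqSmall (θBal F.L γ b₀ p₀ j) V})
    (hθj : 0 < θBal F.L γ b₀ p₀ j) (rc : ℝ) (hrc : 0 ≤ rc) (hguard : (1 + 16 * Real.sqrt 3 * rc) * (θBal F.L γ b₀ p₀ j / 4) ≤ θBal F.L γ b₀ p₀ j)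
    {θmax μ K δ : ℝ} (hδ : 0 < δ) (k : PBond (F.P Ts) 0 → ℝ) (hk0 : ∀ e, 0 ≤ k e) (hK : ∑ e, k e ≤ K)
    (hkμ : ∀ e, k e * δ ≤ μ) (hwin : 4 * (Real.sqrt 3 * μ) ≤ θBal F.L γ b₀ p₀ Ts / 50) (hrad : μ < rA * (49 / 50 * θBal F.L γ b₀ p₀ Ts))
    (hθmax0 : 0 ≤ θmax) (hθle : ∀ n', j + 1 ≤ n' → n' ≤ Ts → θBal F.L γ b₀ p₀ n' ≤ θmax)
    (h24 : stokesConst (F.P Ts) * (24 / 25 * θmax + 4 * ((30 * (((3 + 2) * F.L : ℕ) : ℝ)) ^ (Ts - (j + 1)) * (Real.sqrt 3 * K * δ))) ≤ 1 / 24)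
    -- the D0 chart letters (Dmin), (Dwhite∣MW) (✓(L50b) texts) and the modulus domination
    (δ₀ : ℝ) (hδ₀ : Real.sqrt 3 * (δ * (rc * (θBal F.L γ b₀ p₀ j / 4))) ≤ δ₀)
    (kA kW : PBond (F.P Ts) 0 → ℝ) (hkA0 : ∀ e, 0 ≤ kA e) (hkW0 : ∀ e, 0 ≤ kW e)
    (hk : ∀ e, Real.pi / 2 * Real.sqrt 3 * (Real.sqrt 3 * kA e + Real.pi / 2 * Real.sqrt 3 * kW e) * (Real.sqrt 3 * (rc * (θBal F.L γ b₀ p₀ j / 4))) ≤ k e)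
    (hDmin : ∀ (V : GaugeField (F.P j) 0 ↥(Matrix.specialUnitaryGroup (Fin 2) ℂ)) (b : PBond (F.P j) 0) (u : Fin 3 → ℝ), PlaqSmall (θBal F.L γ b₀ p₀ j) V →
      PlaqSmall (θBal F.L γ b₀ p₀ j) (update V b (V b * expPt u)) → ‖u‖ ≤ δ₀ →
      ∀ e, ∃ a : Fin 3 → ℝ, Amin (update V b (V b * expPt u)) e = Amin V e * expPt a ∧ ‖a‖ ≤ kA e * ‖u‖)
    (hDwhite : ∀ (z : Z) (V : GaugeField (F.P j) 0 ↥(Matrix.specialUnitaryGroup (Fin 2) ℂ)) (b : PBond (F.P j) 0) (u : Fin 3 → ℝ), PlaqSmall (θBal F.L γ b₀ p₀ j) V →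
      PlaqSmall (θBal F.L γ b₀ p₀ j) (update V b (V b * expPt u)) → ‖u‖ ≤ δ₀ →
      (∀ r ∈ Set.Ioo (0:ℝ) 1, ∀ (n : ℕ) (hjn : j + 1 ≤ n) (hnK : n ≤ Ts), PlaqSmall (24 / 25 * θBal F.L γ b₀ p₀ n) (descendTo F ℰp n Ts hnK (Φ (update V b (V b * expPt (r • u)), z)))) →
      ∀ e, ‖Wh (update V b (V b * expPt u)) z e - Wh V z e‖ ≤ kW e * ‖u‖)
    (hcLip : ∀ (V : GaugeField (F.P j) 0 ↥(Matrix.specialUnitaryGroup (Fin 2) ℂ)) (b : PBond (F.P j) 0) (u : Fin 3 → ℝ), PlaqSmall (θBal F.L γ b₀ p₀ j) V →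
      PlaqSmall (θBal F.L γ b₀ p₀ j) (update V b (V b * expPt u)) → ‖u‖ ≤ δ₀ → |cJ (update V b (V b * expPt u)) - cJ V| ≤ Kc * ‖u‖)
    (c : ℝ) (hc : c < 1) (Db : ℝ) (hDb0 : 0 ≤ Db) (DP : Plaq (F.P Ts) 0 → PBond (F.P j) 0 → ℝ) (hDb : ∀ p b, DP p b ≤ Db)
    (hdisp : ∀ (z : Z) (X : GaugeField (F.P j) 0 ↥(Matrix.specialUnitaryGroup (Fin 2) ℂ)), PlaqSmall (θBal F.L γ b₀ p₀ j) X →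
      ∀ (b : PBond (F.P j) 0) (v : Fin 3 → ℝ), ‖v‖ ≤ rc * (θBal F.L γ b₀ p₀ j / 4) → ∀ s ∈ Icc (0 : ℝ) 1, ∀ p : Plaq (F.P Ts) 0,
        dist1 (GaugeField.plaqHol (Φ (update X b (X b * expPt (s • v)), z)) p)
          ≤ dist1 (GaugeField.plaqHol (Φ (X, z)) p) + DP p b * (‖v‖ / (θBal F.L γ b₀ p₀ j / 4)))
    (hroom : 24 / 25 * θBal F.L γ b₀ p₀ Ts + 3 * (Db * rc) ≤ c * θBal F.L γ b₀ p₀ Ts) (t : ℝ) (ht0 : 0 ≤ t) (ht1 : t ≤ 1) :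
    ∀ (B B' : PBond (F.P j) 0) (m m' : Fin 3 → ℝ) (V00 V10 V01 V11 : GaugeField (F.P j) 0 ↥(Matrix.specialUnitaryGroup (Fin 2) ℂ)), ‖m‖ ≤ rc * (θBal F.L γ b₀ p₀ j / 4) → ‖m'‖ ≤ rc * (θBal F.L γ b₀ p₀ j / 4) → PlaqSmall (θBal F.L γ b₀ p₀ j / 4) V00 → PlaqSmall (θBal F.L γ b₀ p₀ j / 4) V10 → PlaqSmall (θBal F.L γ b₀ p₀ j / 4) V01 → PlaqSmall (θBal F.L γ b₀ p₀ j / 4) V11 → (∀ e, e ≠ B → V10 e = V00 e) → V10 B = V00 B * expPt m → (∀ e, e ≠ B' → V01 e = V00 e) → V01 B' = V00 B' * expPt m' → (∀ e, e ≠ B' → V11 e = V10 e) → V11 B' = V10 B' * expPt m' → ∀ (Y : ℝ → GaugeField (F.P j) 0 ↥(Matrix.specialUnitaryGroup (Fin 2) ℂ)) (X : ℝ → ℝ → GaugeField (F.P j) 0 ↥(Matrix.specialUnitaryGroup (Fin 2) ℂ)), (∀ s e, e ≠ B → Y s e = V00 e) → (∀ s, Y s B = V00 B * expPt (s • m)) →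 (∀ s s' e, e ≠ B' → X s s' e = Y s e) → (∀ s s', X s s' B' = Y s B' * expPt (s' • m')) →
      (∃ (b bF bFF : Z → ℝ), Integrable b τ ∧ Integrable bF τ ∧ Integrable bFF τ ∧
        (∀ s' ∈ Set.Icc (0:ℝ) 1, ∀ᵐ z ∂τ, LipschitzOnWith (Real.nnabs (b z)) (fun s => wNum F γ b₀ p₀ j Ts ρ ρ' Φ J t (X s s') z) (Set.Ioo (-1) 2)) ∧
        (∀ s' ∈ Set.Icc (0:ℝ) 1, ∀ᵐ z ∂τ, LipschitzOnWith (Real.nnabs (bF z)) (fun s => (Real.log (ρ Ts (Φ (V00, z))) - Real.log (ρ' Ts (Φ (V00, z)))) * wNum F γ b₀ p₀ j Ts ρ ρ' Φ J t (X s s') z) (Set.Ioo (-1) 2)) ∧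
        (∀ s' ∈ Set.Icc (0:ℝ) 1, ∀ᵐ z ∂τ, LipschitzOnWith (Real.nnabs (bFF z)) (fun s => ((Real.log (ρ Ts (Φ (V00, z))) - Real.log (ρ' Ts (Φ (V00, z)))) * (Real.log (ρ Ts (Φ (V00, z))) - Real.log (ρ' Ts (Φ (V00, z))))) * wNum F γ b₀ p₀ j Ts ρ ρ' Φ J t (X s s') z) (Set.Ioo (-1) 2))) := by
  obtain ⟨bW, hW⟩ := weightLip_of_beta_of_D0 F γ b₀ p₀ j Ts hjTs ρ ρ' hρc hρ'c hρpos hθ hχc hχsupp rA Bρ Bρ' hrA hβ hβ' τ Φ J cJ χ hJfac Amin Wh hΦw S hχread Cc Kc hCc hKc hcJglob hAmin hWh hcJ hθj rc hrc hguard hδ k hk0 hK hkμ hwin hrad hθmax0 hθle h24 δ₀ hδ₀ kA kW hkA0 hkW0 hk hDmin hDwhite hcLip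
  exact ilawRegSq_of_weightLip F γ b₀ p₀ j Ts hjTs ρ ρ' hρc hρ'c hρpos (hθ Ts) hχsupp τ Φ J c hc hθj Db rc hrc hDb0 DP hDb hguard hdisp hroom t bW (hW t ht0 ht1).2

end Summit.QuantumFields.YangMills.Theorems.OrganTangentRegOfD0Primitives

end
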